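import Summits.AtomisticToContinuum.FouriersLaw.Theorems.HonestZwanzigNetworkReductionCircuit

/-!
# `HonestZwanzig.RobinCoercivity` (stmt-AtomisticToContinuum-12695), line LinAlg — stub `stub_feshbachMatrix`

Support file (`--supports` the crux `RobinCoercivity` of route `HonestZwanzig`, sub-problem `FouriersLaw`).
Pure finite-dimensional matrix algebra over an arbitrary finite index type `n`: with
`A = B = sG − χ` (the two Kolmogorov identities against site energies), `D = s(sG − χ) − C` (the
Kolmogorov identity between two generator observables) and the Feshbach matrix
`𝔽 = sχ − C − (D − A G⁻¹ B)`, one has `𝔽 = χ G⁻¹ χ` entrywise (the block `C` cancels, and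
`(sG − χ) G⁻¹ (sG − χ) = s²G − 2sχ + χG⁻¹χ` by `G G⁻¹ = 1 = G⁻¹ G` for `G` positive definite), whence
`ξᵀ𝔽ξ = (χξ)ᵀ G⁻¹ (χξ)` for `χ` symmetric. Adapted from step (4) and `hquad` of
`NetworkReduction.circuit_sandwich` (file `HonestZwanzigNetworkReductionCircuit`), whose helper lemmas
`sum_sum_eq_dotProduct_mulVec`, `mul_mul_apply_eq_sum_sum`, `dotProduct_mulVec_of_symm` are reused.
[folklore: Schur complement / Feshbach map]
-/

noncomputable section

open Finset Matrix
open Summit.AtomisticToContinuum.FouriersLaw.Theorems.HonestZwanzig.NetworkReduction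

namespace Summit.AtomisticToContinuum.FouriersLaw.Theorems.HonestZwanzig.Robin

/-- Entrywise form: with `A = B = sG − χ`, `D = s(sG − χ) − C` and `G` invertible, the Feshbach matrix
`𝔽 = sχ − C − (D − A G⁻¹ B)` is the Schur complement `χ G⁻¹ χ` (the block `C` cancels). [folklore] -/
theorem feshbachMatrix_apply_eq_schur {n : Type*} [Fintype n] [DecidableEq n] (s : ℝ)
    (G χ C : Matrix n n ℝ) (A B D F : n → n → ℝ) (hGu : IsUnit G.det)
    (hA : ∀ x y, A x y = s * G x y - χ x y) (hB : ∀ x y, B x y = s * G x y - χ x y)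
    (hD : ∀ x y, D x y = s * (s * G x y - χ x y) - C x y)
    (hF : ∀ x y, F x y = s * χ x y - C x y - (D x y - ∑ u, ∑ v, A x u * G⁻¹ u v * B v y))
    (x y : n) : F x y = (χ * G⁻¹ * χ) x y := by
  have hGG : G * G⁻¹ = 1 := Matrix.mul_nonsing_inv G hGu
  have hGG' : G⁻¹ * G = 1 := Matrix.nonsing_inv_mul G hGu
  rw [hF, hD]
  have hT : ∀ u v, A x u * G⁻¹ u v * B v y = (s • G - χ) x u * G⁻¹ u v * (s • G - χ) v y := by
    intro u v
    rw [hA, hB]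
    simp only [Matrix.sub_apply, Matrix.smul_apply, smul_eq_mul]
  have hT' : ∑ u, ∑ v, A x u * G⁻¹ u v * B v y = ((s • G - χ) * G⁻¹ * (s • G - χ)) x y := by
    rw [mul_mul_apply_eq_sum_sum]
    exact Finset.sum_congr rfl fun u _ => Finset.sum_congr rfl fun v _ => hT u v
  rw [hT']
  have hmat : (s • G - χ) * G⁻¹ * (s • G - χ) =
      (s * s) • G - s • χ - s • χ + χ * G⁻¹ * χ := by
    have e1 : (s • G - χ) * G⁻¹ = s • (1 : Matrix n n ℝ) - χ * G⁻¹ := by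
      rw [sub_mul, Matrix.smul_mul, hGG]
    rw [e1, sub_mul, mul_sub, mul_sub, Matrix.smul_mul, Matrix.smul_mul, Matrix.one_mul,
      Matrix.one_mul, smul_smul, Matrix.mul_smul, Matrix.mul_assoc χ G⁻¹ G, hGG', Matrix.mul_one]
    abel
  rw [hmat]
  simp only [Matrix.add_apply, Matrix.sub_apply, Matrix.smul_apply, smul_eq_mul]
  ring

/-- STUB `stub_feshbachMatrix` of the crux skeleton (line LinAlg): pure matrix algebra. With
`A = B = sG − χ` (the two Kolmogorov identities against site energies), `D = s(sG − χ) − C` (the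
Kolmogorov identity between two generator observables) and `𝔽 = sχ − C − (D − A G⁻¹ B)`, one has
`ξᵀ𝔽ξ = (χξ)ᵀG⁻¹(χξ)` (`G` positive definite, `χ` symmetric). [folklore: Schur complement] -/
theorem stub_feshbachMatrix {n : Type*} [Fintype n] [DecidableEq n] (s : ℝ) (G χ C : Matrix n n ℝ)
    (A B D F : n → n → ℝ) (hG : G.PosDef) (hχs : ∀ x y, χ x y = χ y x)
    (hA : ∀ x y, A x y = s * G x y - χ x y) (hB : ∀ x y, B x y = s * G x y - χ x y)
    (hD : ∀ x y, D x y = s * (s * G x y - χ x y) - C x y)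
    (hF : ∀ x y, F x y = s * χ x y - C x y - (D x y - ∑ u, ∑ v, A x u * G⁻¹ u v * B v y))
    (ξ : n → ℝ) :
    ∑ x, ∑ y, ξ x * F x y * ξ y = (χ *ᵥ ξ) ⬝ᵥ (G⁻¹ *ᵥ (χ *ᵥ ξ)) := by
  have hGu : IsUnit G.det := (Matrix.isUnit_iff_isUnit_det G).1 hG.isUnit
  have h4 : ∑ x, ∑ y, ξ x * F x y * ξ y = ∑ x, ∑ y, ξ x * (χ * G⁻¹ * χ) x y * ξ y :=
    Finset.sum_congr rfl fun x _ => Finset.sum_congr rfl fun y _ => by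
      rw [feshbachMatrix_apply_eq_schur s G χ C A B D F hGu hA hB hD hF x y]
  rw [h4, sum_sum_eq_dotProduct_mulVec, ← Matrix.mulVec_mulVec, ← Matrix.mulVec_mulVec,
    dotProduct_mulVec_of_symm χ hχs]

end Summit.AtomisticToContinuum.FouriersLaw.Theorems.HonestZwanzig.Robin

end
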